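import Summits.AtomisticToContinuum.Crystallization.Theorems.ShellsToBarlowChart.Negative.Calibration

/-!
# `ShellsToBarlowChart` (stmt-AtomisticToContinuum-9227), negative side III: the tolerance constant and local rigidity margins

Part III of the crux disprover's negative-side lemmas (`Cruxes/ShellsToBarlowChart/Disproof.lean`,
cycle 2; parts I–II: `Calibration.lean`, `ScaleWindow.lean`).

* TOLERANCE.  `GoodShellAtTol η`, `ShellsToBarlowChartTol η` (matching tolerance `η·a` in place of
  `a/100`), `shellsToBarlowChart_iff_tol : ShellsToBarlowChart ↔ ShellsToBarlowChartTol (1/100)`, and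
  `shellsToBarlowChart_false_tol_eighth : ¬ ShellsToBarlowChartTol (1/8)`: the ideal FCC stacking at
  scale `9/8`, DECLARED at scale `a = 1`, has `(1/8)`-matched shells, exactly twelve points in each
  `5/4`-ball, and no pair within the bond window `28/25 < 9/8`
  (`goodShellAtTol_barlowStacking_declared`, `shellSet_eq_of_radius`, `etaMatched_image_image`).
  Reading: the tolerance is load-bearing only through the conclusion's bond window, from `η > 3/25`
  on; any counterexample at smaller tolerance must be geometric.
* LOCAL RIGIDITY MARGINS (why it cannot be geometric at `η = 1/100`).  The pattern pair-distance
  spectra `fccInt_pair_sqNorm` (`{1, √2, √3, 2}·a`) and `hcpInt_pair_sqNorm`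
  (`{1, √2, √(8/3), √3, √(11/3), 2}·a`), the HCP mirror pair `hcpInt_mirror_pair_sqNorm` at `√(8/3)·a`,
  `fccInt_pair_sqNorm_ne`; `equatorPropagation_margin`: seen from an atom `h` on the hexagon of an
  HCP-shelled atom `x`, the mirror pair of `x`'s shell is `√(8/3)·aₓ ± aₓ/50` apart, which is no FCC
  distance `m·a_h ± a_h/50` (scales tied by the shared bond; worst case `m = √3`, margin `> aₓ/40`) —
  so HCP-type propagates along hexagons and HCP layers are complete sheets, with or without the
  `1 %`; `capClash_lt_hardCore` (adjacent sites of a layer cannot put the next layer in different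
  hole classes: cap points `a/√3 ± a/25 < 0.89` apart) and `hardCore_bounds`.

All `[folklore]`; inputs as in part I plus `KissingPatterns` integer models.
-/

noncomputable section

namespace Summit.AtomisticToContinuum.Crystallization.Theorems.ShellsToBarlowChartNegative

open Literature.Geometry.DiscreteGeometry Literature.MathematicalPhysics.StatisticalMechanics
open Summit.AtomisticToContinuum.Crystallization.Theses.PalmUnimodularRigidity

/-- Euclidean `3`-space. -/
local notation "E3" => EuclideanSpace ℝ (Fin 3)

/-! ## The tolerance constant -/

section Tolerance

variable {s : ℤ → ℤ}

/-- The per-point hypothesis with matching tolerance `η·a` in place of `a/100`. [folklore] -/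
def GoodShellAtTol (η lo hi : ℝ) (S : Set E3) (x : E3) : Prop :=
  ∃ a : ℝ, lo ≤ a ∧ a ≤ hi ∧ ∃ T : Finset E3,
    (↑T : Set E3) = (fun y : E3 => y - x) '' {y : E3 | y ∈ S ∧ y ≠ x ∧ dist y x ≤ 5 / 4 * a} ∧
    (ShellCloseTo (η * a) T (Finset.image (fun v : E3 => a • v) fccKissingPattern) ∨
      ShellCloseTo (η * a) T (Finset.image (fun v : E3 => a • v) hcpKissingPattern))

/-- The crux with matching tolerance `η` (scale window `[9/10, 1]`, shell radius `5a/4`, bond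
window `(0, 28/25]` unchanged). [folklore] -/
def ShellsToBarlowChartTol (η : ℝ) : Prop :=
  ∀ S : Set E3, S.Nonempty → (∀ x ∈ S, GoodShellAtTol η (9 / 10) 1 S x) → BarlowChart S

/-- The crux IS the `η = 1/100` instance. [folklore] -/
theorem shellsToBarlowChart_iff_tol : ShellsToBarlowChart ↔ ShellsToBarlowChartTol (1 / 100) := by
  simp only [shellsToBarlowChart_iff_scaled, ShellsToBarlowChartScaled, ShellsToBarlowChartTol,
    GoodShellAt, GoodShellAtTol, one_div_mul_eq_div]

/-- Within any radius `R ∈ [c, √2·c)` a point of the ideal stacking at scale `c` sees exactly its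
touching offsets (`shellSet_eq` is the case `R = 5c/4`). [cite: HalesDSP2012, §1.3] -/
theorem shellSet_eq_of_radius (hs : IsHaggSeq s) {c R : ℝ} (hc : 0 < c) (hcR : c ≤ R)
    (hR : R < Real.sqrt 2 * c) {x : E3} (hx : x ∈ barlowStacking c (c * Real.sqrt (2 / 3)) s) :
    (fun y : E3 => y - x) '' {y : E3 | y ∈ barlowStacking c (c * Real.sqrt (2 / 3)) s ∧ y ≠ x ∧
        dist y x ≤ R}
      = {z : E3 | x + z ∈ barlowStacking c (c * Real.sqrt (2 / 3)) s ∧ ‖z‖ = c} := by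
  ext z
  simp only [Set.mem_image, Set.mem_setOf_eq]
  constructor
  · rintro ⟨y, ⟨hy, hne, hle⟩, rfl⟩
    refine ⟨by simpa using hy, ?_⟩
    have h := dist_eq_of_dist_le_of_lt hs hc (ideal_sq c) hy hx hne hR hle
    rw [← h, dist_eq_norm]
  · rintro ⟨hxz, hz⟩
    refine ⟨x + z, ⟨hxz, ?_, ?_⟩, by simp⟩
    · intro h
      have hz0 : z = 0 := by simpa using h
      rw [hz0, norm_zero] at hz
      exact hc.ne' hz.symm
    · rw [dist_eq_norm, add_sub_cancel_left, hz]
      exact hcR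

/-- Two images of one finite set under injective maps that move each point by `≤ η` are
`η`-matched. [folklore] -/
theorem etaMatched_image_image {η : ℝ} (P : Finset E3) {g g' : E3 → E3}
    (hg : Function.Injective g) (hg' : Function.Injective g')
    (h : ∀ p ∈ P, dist (g p) (g' p) ≤ η) : EtaMatched η (P.image g) (P.image g') := by
  classical
  -- the two parametrisations by `P`
  let ι : ↥P → ↥(P.image g) := fun p => ⟨g p, Finset.mem_image_of_mem g p.2⟩
  let ι' : ↥P → ↥(P.image g') := fun p => ⟨g' p, Finset.mem_image_of_mem g' p.2⟩
  have hι : Function.Bijective ι := by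
    refine ⟨fun p q hpq => Subtype.ext (hg (congrArg Subtype.val hpq)), fun y => ?_⟩
    obtain ⟨p, hp, hpy⟩ := Finset.mem_image.1 y.2
    exact ⟨⟨p, hp⟩, Subtype.ext hpy⟩
  have hι' : Function.Bijective ι' := by
    refine ⟨fun p q hpq => Subtype.ext (hg' (congrArg Subtype.val hpq)), fun y => ?_⟩
    obtain ⟨p, hp, hpy⟩ := Finset.mem_image.1 y.2
    exact ⟨⟨p, hp⟩, Subtype.ext hpy⟩
  refine ⟨(Equiv.ofBijective ι hι).symm.trans (Equiv.ofBijective ι' hι'), fun t => ?_⟩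
  obtain ⟨p, rfl⟩ := hι.2 t
  simp only [Equiv.trans_apply, Equiv.ofBijective_symm_apply_apply, Equiv.ofBijective_apply]
  exact h p p.2

/-- **Declared at the wrong scale.** A point of the ideal stacking at scale `c`, declared at a
scale `a` with `c ≤ 5a/4 < √2·c` and `|c − a| ≤ η·a`, satisfies the per-point hypothesis with
tolerance `η`: its `5a/4`-ball holds exactly the twelve touching points `c·A(v)`, each within
`|c − a|` of the declared pattern point `a·A(v)`. [folklore] -/
theorem goodShellAtTol_barlowStacking_declared (hs : IsHaggSeq s) {η lo hi a c : ℝ} (hc : 0 < c)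
    (hlo : lo ≤ a) (hhi : a ≤ hi) (hca : c ≤ 5 / 4 * a) (hac : 5 / 4 * a < Real.sqrt 2 * c)
    (hη : |c - a| ≤ η * a) {x : E3} (hx : x ∈ barlowStacking c (c * Real.sqrt (2 / 3)) s) :
    GoodShellAtTol η lo hi (barlowStacking c (c * Real.sqrt (2 / 3)) s) x := by
  obtain ⟨k, i, j, rfl⟩ := hx
  refine ⟨a, hlo, hhi, ?_⟩
  -- the `5a/4`-shell is the `5c/4`-shell, i.e. the rescaled kissing shell of Hales's stacking
  have hR := shellSet_eq_of_radius hs hc hca hac (barlowPos_mem (s := s) k i j)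
  have h54 : (5 / 4 * c) < Real.sqrt 2 * c := mul_lt_mul_of_pos_right five_fourths_lt_sqrt_two hc
  have hC := shellSet_eq_of_radius hs hc (by linarith) h54 (barlowPos_mem (s := s) k i j)
  have hshell := shellSet_eq_image_kissingShell hs hc k i j
  rw [hC] at hshell
  rw [hshell] at hR
  -- Hales: the kissing shell is `2·A(P)` for the FCC or the HCP pattern
  have key : ∀ (P : Finset E3) (A : E3 →ₗᵢ[ℝ] E3),
      kissingShell (barlowStacking 2 (2 * Real.sqrt (2 / 3)) s)
          (barlowPos 2 (2 * Real.sqrt (2 / 3)) s k i j) = (fun p => (2 : ℝ) • A p) '' (P : Set E3) →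
      (↑(P.image (fun p : E3 => A (c • p))) : Set E3) =
        (fun z : E3 => (c / 2) • z) ''
          kissingShell (barlowStacking 2 (2 * Real.sqrt (2 / 3)) s)
            (barlowPos 2 (2 * Real.sqrt (2 / 3)) s k i j) := by
    intro P A hA
    rw [hA, Finset.coe_image, Set.image_image]
    refine Set.image_congr' fun p => ?_
    rw [map_smul, smul_smul, show c / 2 * 2 = c by ring]
  -- matching: `A (c • p)` is within `|c - a|` of `A (a • p)` for a unit vector `p`
  have hmatch : ∀ (P : Finset E3) (A : E3 →ₗᵢ[ℝ] E3), (∀ p ∈ P, ‖p‖ = 1) →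
      EtaMatched (η * a) (P.image (fun p : E3 => A (c • p)))
        ((P.image (fun v : E3 => a • v)).image A) := by
    intro P A hP
    rw [Finset.image_image]
    have hane : a ≠ 0 := by
      intro ha0
      rw [ha0] at hca hac
      have := Real.sqrt_nonneg 2
      nlinarith
    refine etaMatched_image_image P ?_ ?_ ?_
    · exact A.injective.comp (smul_right_injective E3 hc.ne')
    · exact A.injective.comp (smul_right_injective E3 hane)
    · intro p hp
      show dist (A (c • p)) (A (a • p)) ≤ η * a
      rw [LinearIsometry.dist_map, dist_eq_norm, ← sub_smul, norm_smul, Real.norm_eq_abs, hP p hp,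
        mul_one]
      exact hη
  rcases hasFccOrHcpShells_barlowStacking' hs _ (barlowPos_mem k i j) with ⟨A, hA⟩ | ⟨A, hA⟩
  · refine ⟨fccKissingPattern.image (fun p : E3 => A (c • p)), ?_, Or.inl ⟨A, ?_⟩⟩
    · rw [hR, key _ A hA]
    · exact hmatch _ A fun p hp => norm_eq_one_of_mem_fccKissingPattern hp
  · refine ⟨hcpKissingPattern.image (fun p : E3 => A (c • p)), ?_, Or.inr ⟨A, ?_⟩⟩
    · rw [hR, key _ A hA]
    · exact hmatch _ A fun p hp => norm_eq_one_of_mem_hcpKissingPattern hp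

/-- `5/4 < √2 · 9/8`. [folklore] -/
theorem five_fourths_lt_sqrt_two_mul : (5 / 4 : ℝ) * 1 < Real.sqrt 2 * (9 / 8) := by
  have := five_fourths_lt_sqrt_two
  linarith

/-- **The tolerance is load-bearing only through the window, at `η ≥ 1/8`**: with matching
tolerance `a/8` the crux is false — the ideal FCC stacking at scale `9/8` declared at scale `1`
satisfies the hypothesis, but no two of its points are within `28/25 < 9/8`, so no touching pair
of the unit stacking can be mapped to a window pair. [folklore] -/
theorem shellsToBarlowChart_false_tol_eighth : ¬ ShellsToBarlowChartTol (1 / 8) := by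
  intro h
  obtain ⟨s, hs, Φ, hbij, hiff⟩ :=
    h (barlowStacking (9 / 8) (9 / 8 * Real.sqrt (2 / 3)) constHagg) ⟨_, barlowPos_mem 0 0 0⟩
      (fun x hx => goodShellAtTol_barlowStacking_declared isHaggSeq_const (η := 1 / 8) (a := 1)
        (c := 9 / 8) (by norm_num) (by norm_num) le_rfl (by norm_num) five_fourths_lt_sqrt_two_mul
        (by norm_num [abs_of_pos]) hx)
  have hh : Real.sqrt (2 / 3) ^ 2 = 2 / 3 * (1 : ℝ) ^ 2 := by
    rw [Real.sq_sqrt (by norm_num)]; ring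
  have hpq : dist (barlowPos 1 (Real.sqrt (2 / 3)) s 0 0 0) (barlowPos 1 (Real.sqrt (2 / 3)) s 0 1 0)
      = 1 := by
    rw [dist_barlowPos_eq_iff hs one_pos hh]
    exact Or.inl ⟨rfl, by decide⟩
  obtain ⟨hpos, hle⟩ := (hiff _ (barlowPos_mem 0 0 0) _ (barlowPos_mem 0 1 0)).1 hpq
  have hne : Φ (barlowPos 1 (Real.sqrt (2 / 3)) s 0 0 0) ≠
      Φ (barlowPos 1 (Real.sqrt (2 / 3)) s 0 1 0) := by
    intro e; rw [e, dist_self] at hpos; exact lt_irrefl _ hpos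
  have h98 : (9 / 8 : ℝ) ≤ dist (Φ (barlowPos 1 (Real.sqrt (2 / 3)) s 0 0 0))
      (Φ (barlowPos 1 (Real.sqrt (2 / 3)) s 0 1 0)) :=
    le_dist_of_mem_barlowStacking_ideal isHaggSeq_const (by norm_num) (ideal_sq (9 / 8))
      (hbij.mapsTo (barlowPos_mem 0 0 0)) (hbij.mapsTo (barlowPos_mem 0 1 0)) hne
  linarith

end Tolerance

/-! ## Local rigidity margins -/

section LocalRigidity

/-- FCC pattern: squared pair distances, in units where the bond has squared length `2`, lie in
`{2, 4, 6, 8}` — i.e. pair distances `{1, √2, √3, 2}·a`. [cite: ConwaySloane1999, Ch. 4 §6.3] -/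
theorem fccInt_pair_sqNorm :
    ∀ v ∈ fccInt, ∀ w ∈ fccInt, v ≠ w → sqNormInt (v - w) ∈ ({2, 4, 6, 8} : Finset ℤ) := by
  decide

/-- HCP pattern: squared pair distances, in units where the bond has squared length `18`, lie in
`{18, 36, 48, 54, 66, 72}` — i.e. `{1, √2, √(8/3), √3, √(11/3), 2}·a`. [cite: HalesDSP2012, §1.3] -/
theorem hcpInt_pair_sqNorm :
    ∀ v ∈ hcpInt, ∀ w ∈ hcpInt, v ≠ w →
      sqNormInt (v - w) ∈ ({18, 36, 48, 54, 66, 72} : Finset ℤ) := by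
  decide

/-- The mirror pair across the hexagon plane — upper cap point `(3,3,0)` and lower cap point
`(−1,−1,−4)` of `hcpInt`, both bonded to the two hexagon points `(3,0,−3)`, `(0,3,−3)` — is at
squared distance `48 = (8/3)·18`: the value `√(8/3)·a` that no FCC shell produces.
[cite: HalesDSP2012, §1.3] -/
theorem hcpInt_mirror_pair_sqNorm : sqNormInt (![3, 3, 0] - ![-1, -1, -4]) = 48 := by decide

/-- `3 ∤ 16`: no FCC pair has squared distance `(8/3)·(bond)²`. [folklore] -/
theorem fccInt_pair_sqNorm_ne : ∀ v ∈ fccInt, ∀ w ∈ fccInt, 3 * sqNormInt (v - w) ≠ 16 := by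
  decide

/-- `√2 < 1.4143`. [folklore] -/
theorem sqrt_two_lt' : Real.sqrt 2 < 14143 / 10000 := by
  rw [show (14143 / 10000 : ℝ) = Real.sqrt ((14143 / 10000) ^ 2) by rw [Real.sqrt_sq]; norm_num]
  exact Real.sqrt_lt_sqrt (by norm_num) (by norm_num)

/-- `1.732 < √3`. [folklore] -/
theorem lt_sqrt_three' : (1732 / 1000 : ℝ) < Real.sqrt 3 := by
  rw [show (1732 / 1000 : ℝ) = Real.sqrt ((1732 / 1000) ^ 2) by rw [Real.sqrt_sq]; norm_num]
  exact Real.sqrt_lt_sqrt (by norm_num) (by norm_num)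

/-- `1.6329 < √(8/3) < 1.633`. [folklore] -/
theorem sqrt_eight_thirds_bounds :
    (16329 / 10000 : ℝ) < Real.sqrt (8 / 3) ∧ Real.sqrt (8 / 3) < 1633 / 1000 := by
  constructor
  · rw [show (16329 / 10000 : ℝ) = Real.sqrt ((16329 / 10000) ^ 2) by rw [Real.sqrt_sq]; norm_num]
    exact Real.sqrt_lt_sqrt (by norm_num) (by norm_num)
  · rw [show (1633 / 1000 : ℝ) = Real.sqrt ((1633 / 1000) ^ 2) by rw [Real.sqrt_sq]; norm_num]
    exact Real.sqrt_lt_sqrt (by norm_num) (by norm_num)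

/-- **HCP-equator propagation is robust at the crux's tolerance.**  Let `x` be HCP-shelled at
scale `aₓ` and `h` a point of its hexagon, shelled (FCC or HCP) at scale `a_h`; the shared bond
gives `0.99·aₓ ≤ 1.01·a_h` and `0.99·a_h ≤ 1.01·aₓ`.  The mirror pair `u, l` of `x`'s shell lies
in `h`'s shell at mutual distance `√(8/3)·aₓ ± aₓ/50`, which in `h`'s frame must be a pattern
distance `m·a_h ± a_h/50`.  For the four FCC values `m ∈ {1, √2, √3, 2}` the discrepancy exceeds
the total budget `(aₓ + a_h)/50` — so `h` is NOT FCC-shelled (and in the HCP pattern only the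
mirror pairs `√(8/3)` qualify, by `hcpInt_pair_sqNorm` and the same margins for `√(11/3)`, `2`).
Worst case `m = √3`, margin `> aₓ/40`. [folklore] -/
theorem equatorPropagation_margin {ax ah : ℝ} (hx : 0 < ax) (h₁ : 99 / 100 * ax ≤ 101 / 100 * ah)
    (h₂ : 99 / 100 * ah ≤ 101 / 100 * ax) {m : ℝ}
    (hm : m = 1 ∨ m = Real.sqrt 2 ∨ m = Real.sqrt 3 ∨ m = 2) :
    1 / 50 * (ax + ah) < |Real.sqrt (8 / 3) * ax - m * ah| := by
  have hah : 0 < ah := by linarith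
  obtain ⟨h83l, h83u⟩ := sqrt_eight_thirds_bounds
  have hA : 16329 / 10000 * ax ≤ Real.sqrt (8 / 3) * ax := mul_le_mul_of_nonneg_right h83l.le hx.le
  have hB : Real.sqrt (8 / 3) * ax ≤ 1633 / 1000 * ax := mul_le_mul_of_nonneg_right h83u.le hx.le
  rcases hm with rfl | rfl | rfl | rfl
  · rw [one_mul]
    exact lt_abs.2 (Or.inl (by linarith))
  · have hC : Real.sqrt 2 * ah ≤ 14143 / 10000 * ah :=
      mul_le_mul_of_nonneg_right sqrt_two_lt'.le hah.le
    exact lt_abs.2 (Or.inl (by linarith))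
  · have hC : 1732 / 1000 * ah ≤ Real.sqrt 3 * ah :=
      mul_le_mul_of_nonneg_right lt_sqrt_three'.le hah.le
    exact lt_abs.2 (Or.inr (by linarith))
  · exact lt_abs.2 (Or.inr (by linarith))

/-- **Adjacent sites of one layer cannot mix types**: the clash distance.  If two bonded sites of a
layer put the next layer in different hole classes, an upper-cap point of one and an upper-cap
point of the other are ideally `a/√3` apart; even with `4 %` of slack this is below the hard core
`0.89` for every `a ≤ 1`: `(1/√3 + 1/25)·a < 89/100`. [folklore] -/
theorem capClash_lt_hardCore {a : ℝ} (h1 : a ≤ 1) :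
    (Real.sqrt (1 / 3) + 1 / 25) * a < 89 / 100 := by
  have hs : Real.sqrt (1 / 3) < 5774 / 10000 := by
    rw [show (5774 / 10000 : ℝ) = Real.sqrt ((5774 / 10000) ^ 2) by rw [Real.sqrt_sq]; norm_num]
    exact Real.sqrt_lt_sqrt (by norm_num) (by norm_num)
  have : (Real.sqrt (1 / 3) + 1 / 25) * a ≤ (Real.sqrt (1 / 3) + 1 / 25) * 1 :=
    mul_le_mul_of_nonneg_left h1 (by positivity)
  linarith

/-- **The hard core of an every-point-good set**: two shell bounds give it.  A point within
`5aₓ/4` of `x` is a shell point, at distance `≥ (1 − 1/100)·aₓ ≥ 0.891`; anything else is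
`> 5aₓ/4 ≥ 1.125` away. [folklore] -/
theorem hardCore_bounds {a : ℝ} (h9 : 9 / 10 ≤ a) :
    (891 / 1000 : ℝ) ≤ (1 - 1 / 100) * a ∧ (1125 / 1000 : ℝ) ≤ 5 / 4 * a := by
  constructor <;> linarith

end LocalRigidity

end Summit.AtomisticToContinuum.Crystallization.Theorems.ShellsToBarlowChartNegative
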